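import Summits.QuantumAdvantage.QuantumAdvantage.Theorems.CubicForrelationNearExactIsExactCubicFormR2PartnerCells
import Summits.QuantumAdvantage.QuantumAdvantage.Theorems.CubicForrelationNearExactIsExactCubicFormUnitTable

/-!
# Crux `CubicForrelation.NearExactIsExact` (stmt-QuantumAdvantage-14043) — E1280-even, R2 branch, hyperplane levels: INDEX TABLES
  (from the `castLE` coordinates of `tpw_R2_hyperplane_of_levels` to the `1 + 8` format of the cell lemmas and the leaf tables `hT/hlo/hhi`)

Certificate seat `b2b-cforr-cert` (gen 42).  HONEST FRAMING: kernel-checked index bookkeeping (standard axioms), shared by the four level files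
`HL h` (h = 1..4) of …CubicFormR2PartnerHyperplane: the light cell's third differences arrive with coordinates `castLE hk (…)` of `Fin 9`
(`hk : 1+h+h ≤ 9`); the cell lemmas (…CubicFormCellL2 `tl2_cell_eight`, …CubicFormLightStructure, …CubicFormCellLT) want `Fin (1 + 8)` with
`lo hi : Fin h → Fin 8`, and the leaves (`tpa_R2_w8`, …) want the `𝔽₂`-tables of the `S`-block of `d` at unit vectors (`hT`, `hlo`, `hhi`)
with the order facts.  This file converts once: `lo a = ⟨a⟩`, `hi a = ⟨h + a⟩`.  Nothing about `θ₁₂`; NOT summit progress.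

* `tpw_R2_level_tables`: the statement above (uses `tpw_R2_cells` for "the `S`-block of `d` is the cubic form of every cell" and
  `tlu_unit_table`).

References: this seat lineage (g41 UnitTable/CellL2, g42 hyperplane levels).  Axioms: the standard three.
-/

set_option linter.dupNamespace false -- D-0017: single-problem summit ⇒ `QuantumAdvantage.QuantumAdvantage` by design

namespace Summit.QuantumAdvantage.QuantumAdvantage.Theorems.CubicForrelation.NearExactIsExact

open Finset
open Literature.Computability.QuantumComplexity
open Literature.Computability.QuantumComplexity.BuzetChailloux (bxor zeroVec bxor_comm bxor_self bxor_zeroVec zeroVec_bxor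
  bxor_bxor_cancel_left)

/-- **Index tables for the hyperplane levels.**  See the module docstring. [this work] -/
theorem tpw_R2_level_tables (κ : (Fin (3 + 9) → Bool) → Bool) (hκ : IsDegLeFun 3 κ)
    (d : Fin (3 + 9) → Fin (3 + 9) → Fin (3 + 9) → ZMod 2)
    (hd : ∀ φ j k, d φ j k =
      if ((((κ zeroVec ^^ κ (bxor zeroVec (fun l => decide (l = k)))) ^^
            (κ (bxor zeroVec (fun l => decide (l = j))) ^^ κ (bxor (bxor zeroVec (fun l => decide (l = j))) (fun l => decide (l = k))))) ^^
          ((κ (bxor zeroVec (fun l => decide (l = φ))) ^^ κ (bxor (bxor zeroVec (fun l => decide (l = φ))) (fun l => decide (l = k)))) ^^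
            (κ (bxor (bxor zeroVec (fun l => decide (l = φ))) (fun l => decide (l = j))) ^^
              κ (bxor (bxor (bxor zeroVec (fun l => decide (l = φ))) (fun l => decide (l = j))) (fun l => decide (l = k))))))) = true
      then 1 else 0)
    (hD0 : ∀ y, (κ y ^^ κ (bxor y (fun l => decide (l = Fin.castAdd 9 (0 : Fin 3))))) =
      (y (Fin.castAdd 9 (1 : Fin 3)) && y (Fin.castAdd 9 (2 : Fin 3))))
    (i j : Bool) (h : ℕ) (hk : 1 + h + h ≤ 9)
    (hT : ∀ u v w x : Fin 9 → Bool,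
      ((((κ (Fin.append ![false, i, j] x) ^^ κ (Fin.append ![false, i, j] (bxor x w))) ^^
              (κ (Fin.append ![false, i, j] (bxor x v)) ^^ κ (Fin.append ![false, i, j] (bxor (bxor x v) w)))) ^^
            ((κ (Fin.append ![false, i, j] (bxor x u)) ^^ κ (Fin.append ![false, i, j] (bxor (bxor x u) w))) ^^
              (κ (Fin.append ![false, i, j] (bxor (bxor x u) v)) ^^
                κ (Fin.append ![false, i, j] (bxor (bxor (bxor x u) v) w)))))) =
      ((((u (Fin.castLE hk (Fin.castAdd h (Fin.castAdd h (0 : Fin 1)))) &&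
            decide ((∑ ii : Fin h, ((if v (Fin.castLE hk (Fin.castAdd h (Fin.natAdd 1 ii))) = true then (1 : ZMod 2) else 0) * (if w (Fin.castLE hk (Fin.natAdd (1 + h) ii)) = true then (1 : ZMod 2) else 0) +
              (if v (Fin.castLE hk (Fin.natAdd (1 + h) ii)) = true then (1 : ZMod 2) else 0) * (if w (Fin.castLE hk (Fin.castAdd h (Fin.natAdd 1 ii))) = true then (1 : ZMod 2) else 0))) = 1)) ^^
          (v (Fin.castLE hk (Fin.castAdd h (Fin.castAdd h (0 : Fin 1)))) &&
            decide ((∑ ii : Fin h, ((if u (Fin.castLE hk (Fin.castAdd h (Fin.natAdd 1 ii))) = true then (1 : ZMod 2) else 0) * (if w (Fin.castLE hk (Fin.natAdd (1 + h) ii)) = true then (1 : ZMod 2) else 0) +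
              (if u (Fin.castLE hk (Fin.natAdd (1 + h) ii)) = true then (1 : ZMod 2) else 0) * (if w (Fin.castLE hk (Fin.castAdd h (Fin.natAdd 1 ii))) = true then (1 : ZMod 2) else 0))) = 1))) ^^
          (w (Fin.castLE hk (Fin.castAdd h (Fin.castAdd h (0 : Fin 1)))) &&
            decide ((∑ ii : Fin h, ((if u (Fin.castLE hk (Fin.castAdd h (Fin.natAdd 1 ii))) = true then (1 : ZMod 2) else 0) * (if v (Fin.castLE hk (Fin.natAdd (1 + h) ii)) = true then (1 : ZMod 2) else 0) +
              (if u (Fin.castLE hk (Fin.natAdd (1 + h) ii)) = true then (1 : ZMod 2) else 0) * (if v (Fin.castLE hk (Fin.castAdd h (Fin.natAdd 1 ii))) = true then (1 : ZMod 2) else 0))) = 1))))) :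
    ∃ (lo hi : Fin h → Fin 8),
      Function.Injective lo ∧ Function.Injective hi ∧ (∀ a b, lo a ≠ hi b) ∧
      (∀ a, (lo a).val = a.val) ∧ (∀ a, (hi a).val = h + a.val) ∧
      (∀ u v w x : Fin (1 + 8) → Bool,
        ((((κ (Fin.append ![false, i, j] x) ^^ κ (Fin.append ![false, i, j] (bxor x w))) ^^
              (κ (Fin.append ![false, i, j] (bxor x v)) ^^ κ (Fin.append ![false, i, j] (bxor (bxor x v) w)))) ^^
            ((κ (Fin.append ![false, i, j] (bxor x u)) ^^ κ (Fin.append ![false, i, j] (bxor (bxor x u) w))) ^^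
              (κ (Fin.append ![false, i, j] (bxor (bxor x u) v)) ^^
                κ (Fin.append ![false, i, j] (bxor (bxor (bxor x u) v) w)))))) =
        ((((u (Fin.castAdd 8 (0 : Fin 1)) &&
            decide ((∑ ii : Fin h, ((if (fun jj => v (Fin.natAdd 1 jj)) (lo ii) = true then (1 : ZMod 2) else 0) * (if (fun jj => w (Fin.natAdd 1 jj)) (hi ii) = true then (1 : ZMod 2) else 0) +
              (if (fun jj => v (Fin.natAdd 1 jj)) (hi ii) = true then (1 : ZMod 2) else 0) * (if (fun jj => w (Fin.natAdd 1 jj)) (lo ii) = true then (1 : ZMod 2) else 0))) = 1)) ^^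
          (v (Fin.castAdd 8 (0 : Fin 1)) &&
            decide ((∑ ii : Fin h, ((if (fun jj => u (Fin.natAdd 1 jj)) (lo ii) = true then (1 : ZMod 2) else 0) * (if (fun jj => w (Fin.natAdd 1 jj)) (hi ii) = true then (1 : ZMod 2) else 0) +
              (if (fun jj => u (Fin.natAdd 1 jj)) (hi ii) = true then (1 : ZMod 2) else 0) * (if (fun jj => w (Fin.natAdd 1 jj)) (lo ii) = true then (1 : ZMod 2) else 0))) = 1))) ^^
          (w (Fin.castAdd 8 (0 : Fin 1)) &&
            decide ((∑ ii : Fin h, ((if (fun jj => u (Fin.natAdd 1 jj)) (lo ii) = true then (1 : ZMod 2) else 0) * (if (fun jj => v (Fin.natAdd 1 jj)) (hi ii) = true then (1 : ZMod 2) else 0) +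
              (if (fun jj => u (Fin.natAdd 1 jj)) (hi ii) = true then (1 : ZMod 2) else 0) * (if (fun jj => v (Fin.natAdd 1 jj)) (lo ii) = true then (1 : ZMod 2) else 0))) = 1))))) ∧
      (∀ s u : Fin (1 + 8), d (Fin.natAdd 3 (Fin.castAdd 8 (0 : Fin 1))) (Fin.natAdd 3 s) (Fin.natAdd 3 u) =
        ∑ q, (if (s = Fin.natAdd 1 (lo q) ∧ u = Fin.natAdd 1 (hi q)) ∨ (s = Fin.natAdd 1 (hi q) ∧ u = Fin.natAdd 1 (lo q))
          then (1 : ZMod 2) else 0)) ∧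
      (∀ q (s u : Fin (1 + 8)), d (Fin.natAdd 3 (Fin.natAdd 1 (lo q))) (Fin.natAdd 3 s) (Fin.natAdd 3 u) =
        if (s = Fin.castAdd 8 (0 : Fin 1) ∧ u = Fin.natAdd 1 (hi q)) ∨ (s = Fin.natAdd 1 (hi q) ∧ u = Fin.castAdd 8 (0 : Fin 1)) then 1 else 0) ∧
      (∀ q (s u : Fin (1 + 8)), d (Fin.natAdd 3 (Fin.natAdd 1 (hi q))) (Fin.natAdd 3 s) (Fin.natAdd 3 u) =
        if (s = Fin.castAdd 8 (0 : Fin 1) ∧ u = Fin.natAdd 1 (lo q)) ∨ (s = Fin.natAdd 1 (lo q) ∧ u = Fin.castAdd 8 (0 : Fin 1)) then 1 else 0) := by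
  obtain ⟨-, htb, -⟩ := tpw_R2_cells κ hκ d hd hD0
  refine ⟨fun a => ⟨a.val, by omega⟩, fun a => ⟨h + a.val, by omega⟩, fun a b hab => ?_, fun a b hab => ?_, fun a b hab => ?_,
    fun a => rfl, fun a => rfl, ?_⟩
  · exact Fin.ext (by simpa using congrArg Fin.val hab)
  · exact Fin.ext (by simpa using congrArg Fin.val hab)
  · have := congrArg Fin.val hab; simp at this; omega
  -- index identities in `Fin 9 = Fin (1 + 8)`
  have i0 : (Fin.castLE hk (Fin.castAdd h (Fin.castAdd h (0 : Fin 1))) : Fin 9) = Fin.castAdd 8 (0 : Fin 1) :=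
    Fin.ext (by simp)
  have ilo : ∀ a : Fin h, (Fin.castLE hk (Fin.castAdd h (Fin.natAdd 1 a)) : Fin 9) = Fin.natAdd 1 (⟨a.val, by omega⟩ : Fin 8) :=
    fun a => Fin.ext (by simp)
  have ihi : ∀ a : Fin h, (Fin.castLE hk (Fin.natAdd (1 + h) a) : Fin 9) = Fin.natAdd 1 (⟨h + a.val, by omega⟩ : Fin 8) :=
    fun a => Fin.ext (by simp; omega)
  have hT' : ∀ u v w x : Fin (1 + 8) → Bool,
      ((((κ (Fin.append ![false, i, j] x) ^^ κ (Fin.append ![false, i, j] (bxor x w))) ^^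
              (κ (Fin.append ![false, i, j] (bxor x v)) ^^ κ (Fin.append ![false, i, j] (bxor (bxor x v) w)))) ^^
            ((κ (Fin.append ![false, i, j] (bxor x u)) ^^ κ (Fin.append ![false, i, j] (bxor (bxor x u) w))) ^^
              (κ (Fin.append ![false, i, j] (bxor (bxor x u) v)) ^^
                κ (Fin.append ![false, i, j] (bxor (bxor (bxor x u) v) w)))))) =
      ((((u (Fin.castAdd 8 (0 : Fin 1)) &&
            decide ((∑ ii : Fin h, ((if (fun jj => v (Fin.natAdd 1 jj)) ((fun a : Fin h => (⟨a.val, by omega⟩ : Fin 8)) ii) = true then (1 : ZMod 2) else 0) * (if (fun jj => w (Fin.natAdd 1 jj)) ((fun a : Fin h => (⟨h + a.val, by omega⟩ : Fin 8)) ii) = true then (1 : ZMod 2) else 0) +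
              (if (fun jj => v (Fin.natAdd 1 jj)) ((fun a : Fin h => (⟨h + a.val, by omega⟩ : Fin 8)) ii) = true then (1 : ZMod 2) else 0) * (if (fun jj => w (Fin.natAdd 1 jj)) ((fun a : Fin h => (⟨a.val, by omega⟩ : Fin 8)) ii) = true then (1 : ZMod 2) else 0))) = 1)) ^^
          (v (Fin.castAdd 8 (0 : Fin 1)) &&
            decide ((∑ ii : Fin h, ((if (fun jj => u (Fin.natAdd 1 jj)) ((fun a : Fin h => (⟨a.val, by omega⟩ : Fin 8)) ii) = true then (1 : ZMod 2) else 0) * (if (fun jj => w (Fin.natAdd 1 jj)) ((fun a : Fin h => (⟨h + a.val, by omega⟩ : Fin 8)) ii) = true then (1 : ZMod 2) else 0) +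
              (if (fun jj => u (Fin.natAdd 1 jj)) ((fun a : Fin h => (⟨h + a.val, by omega⟩ : Fin 8)) ii) = true then (1 : ZMod 2) else 0) * (if (fun jj => w (Fin.natAdd 1 jj)) ((fun a : Fin h => (⟨a.val, by omega⟩ : Fin 8)) ii) = true then (1 : ZMod 2) else 0))) = 1))) ^^
          (w (Fin.castAdd 8 (0 : Fin 1)) &&
            decide ((∑ ii : Fin h, ((if (fun jj => u (Fin.natAdd 1 jj)) ((fun a : Fin h => (⟨a.val, by omega⟩ : Fin 8)) ii) = true then (1 : ZMod 2) else 0) * (if (fun jj => v (Fin.natAdd 1 jj)) ((fun a : Fin h => (⟨h + a.val, by omega⟩ : Fin 8)) ii) = true then (1 : ZMod 2) else 0) +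
              (if (fun jj => u (Fin.natAdd 1 jj)) ((fun a : Fin h => (⟨h + a.val, by omega⟩ : Fin 8)) ii) = true then (1 : ZMod 2) else 0) * (if (fun jj => v (Fin.natAdd 1 jj)) ((fun a : Fin h => (⟨a.val, by omega⟩ : Fin 8)) ii) = true then (1 : ZMod 2) else 0))) = 1)))) := by
    intro u v w x
    have e := hT u v w x
    simp only [i0, ilo, ihi] at e
    exact e
  refine ⟨hT', ?_⟩
  have ht := tlu_unit_table (n := 8) (h := h) (fun s : Fin (1 + 8) → Bool => κ (Fin.append ![false, i, j] s))
    (fun a => ⟨a.val, by omega⟩) (fun a => ⟨h + a.val, by omega⟩)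
    (fun a b hab => Fin.ext (by simpa using congrArg Fin.val hab)) (fun a b hab => Fin.ext (by simpa using congrArg Fin.val hab))
    (fun a b hab => by have := congrArg Fin.val hab; simp at this; omega) _ (fun v w => rfl) hT'
  dsimp only at ht
  obtain ⟨t0, tlo, thi⟩ := ht
  refine ⟨fun s u => ?_, fun q s u => ?_, fun q s u => ?_⟩
  · rw [htb ![false, i, j] _ _ _ zeroVec]; exact t0 s u
  · rw [htb ![false, i, j] _ _ _ zeroVec]; exact tlo q s u
  · rw [htb ![false, i, j] _ _ _ zeroVec]; exact thi q s u

end Summit.QuantumAdvantage.QuantumAdvantage.Theorems.CubicForrelation.NearExactIsExact
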